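import Summits.CriticalPhenomena.SAWScalingLimit.Theses.SAWLoopFugacityFlow
import Summits.CriticalPhenomena.SAWScalingLimit.Theorems.AvoidanceLimit.Negative.AvoidanceLimitExponentRigidity
import Literature.Probability.LatticeModels.DiluteLoopModel
import Literature.Probability.RandomPlanarGeometry.HullSubdomainPullback
import Literature.Probability.RandomPlanarGeometry.JordanDomainProofs
import Literature.Probability.RandomPlanarGeometry.RestrictionHullsProofs

/-!
# Line `symplectic-fermion-anchor` for the crux `AvoidanceLimit` (stmt-CriticalPhenomena-10649)

Crux (route `SAWLoopFugacityFlow`, rank 2):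
`Summit.CriticalPhenomena.SAWScalingLimit.Theses.SAWLoopFugacityFlow.AvoidanceLimit` — for every
Dobrushin domain `(D; a, b)`, hull subdomain `D'`, endpoint approximation, chordal uniformizer `φ`,
pulled-back hull `A` and restriction data `(Φ, d = Φ'_A(0))`, the critical `δℤ²` SAW probability
`P_δ(range γ_δ ⊆ closure D')` tends to `d^(5/8)` as `δ → 0+`.

## The line (idea card `Ideas/symplectic-fermion-anchor.md`, triage r1-1/2/3: pass ×3)

Run the route's loop-fugacity continuation from the OTHER exactly solvable end of the strictly
dilute `ℤ²` family: the loop(`n`)+dimer(`t`) dressed self-avoiding walk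
`Z_{n,t,x}(G, Λ; a, b) = Σ x^{#edges} n^{#loops} t^{#dimers}` (path `a → b`, vertex-disjoint simple
loops and doubled edges), taken along the path `(n, t, w) = (n, n/2, 0)`, `n ∈ [-2, 0]`:

* at `(n, t, x) = (-2, -1, x)` it is DETERMINANTAL — `Z(G,Λ;a,b) = adj(1 - xA)_{ab}`,
  `Z(G,Λ;∅) = det(1 - xA)` (adjugate path expansion, `stub_determinantal`) — so at `x = 1/4` the
  doubly normalised two-leg ratio is a ratio of simple-random-walk Green's functions, whose limit
  `d = Φ'_A(0)^1` is discrete potential theory (`stub_excursionRatio`): the free symplectic fermion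
  (`c = -2`, `κ = 2`, boundary weight `b = 1`) is the ANCHOR (`SymplecticAnchor`, proved here from the
  two stubs);
* the window out of the anchor (`stub_symplecticWindow : SymplecticAnchor → SymplecticWindow`,
  the hardest stub: marginal constructive fermionic RG, `b(n) - 1 ≍ -(3/4π)√(n+2)`) gives
  `lim_δ R_δ(n) = d^{b(n)}` for `n ∈ (-2, -2+ε₀]` along the intrinsic critical curve `xcDim n (n/2)`;
* `δ`-uniform analyticity/boundedness of `n ↦ R_δ(n)` on complex neighbourhoods of `[-2+η, 0]`
  for every `η > 0` — NOT of the anchor, which is a square-root branch point of `b` (triage r1-1,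
  r1-3) — (`stub_fugacityContinuation`) and a Vitali–Porter + identity-theorem transport lemma
  specific to the Coulomb-gas exponent `bExp` (`stub_vitaliTransport`) give `lim_δ R_δ(0) = d^{5/8}`
  (`bExp 0 = 5/8`, kernel-checked below);
* at `(0, 0, x_c)` the ratio IS the SAW avoidance probability of the crux, on the nose
  (`stub_sawEndpoint`: the numerator lives on the CONFINED graph — `Ω_δ`-edges whose closed segment
  stays in `closure D'` — so no largest-component bookkeeping appears), once the intrinsic curve is
  identified at the SAW end, `xcDim 0 0 = 1/μ(ℤ²)` (`stub_sawCriticalPoint`, Hammersley–Welsh).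

`AvoidanceLimit_of` composes the seven registered stubs into the crux BY NAME (no `sorry` outside
`stub_*`). Disproof.lean (cdisprove cycle 1) honoured: chordal `φ` and both normalisations of `Φ_A`
are used at `stub_excursionRatio`/`stub_symplecticWindow` (they pin WHICH prime ends carry the two
legs and the value `d`) and in the glue (`0 < d` via `IsStarHull.pullbackHull` — hull identification
+ chordal `φ`); reachability is used in the glue (`eventually_good`) and in `stub_sawEndpoint`; the
ε-ball clause is kept verbatim everywhere (near-miss `WithoutBall`). Landed `Negative/` lemmas
imported: `avoidanceLimit_not_exp` (no exponent-blind argument can close the crux — here `5/8` enters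
as `bExp 0`, the Coulomb-gas exponent continued from the window), `restrictionDeriv_lt_one`.
-/

noncomputable section

open scoped BigOperators Topology symmDiff
open Filter Finset
open Literature.Probability.RandomPlanarGeometry Literature.Probability.LatticeModels
open Summit.CriticalPhenomena.SAWScalingLimit.Theses.SAWLoopFugacityFlow (AvoidanceLimit)

namespace Summit.CriticalPhenomena.SAWScalingLimit.Cruxes.AvoidanceLimit.SymplecticFermionAnchor

/-! ## 1. The loop + dimer dressed SAW on finite pieces of `ℤ²` (built on the tree's `DiluteLoopModel` at `w = 0`) -/

section Model

variable {K : Type*} [Field K]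

/-- The vertices of `Λ` covered by the edge set `M`. -/
def covered (Λ : Finset (Site 2)) (M : Finset (Sym2 (Site 2))) : Finset (Site 2) :=
  open scoped Classical in Λ.filter fun v => ∃ e ∈ M, v ∈ e

/-- DIMER configurations: sets `M` of pairwise vertex-disjoint edges of `G` inside `Λ` (doubled
edges = the 2-cycles of the determinant expansion) avoiding the source set `A`. -/
def dimerConfigs (G : SimpleGraph (Site 2)) [G.LocallyFinite] (Λ A : Finset (Site 2)) :
    Finset (Finset (Sym2 (Site 2))) :=
  open scoped Classical in
  (edgesIn G Λ).powerset.filter fun M =>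
    (∀ v ∈ Λ, #(M.filter fun e => v ∈ e) ≤ 1) ∧ ∀ v ∈ A, ∀ e ∈ M, v ∉ e

/-- **`Z_{n,t,x}(G, Λ; A)`** — the partition function of the SAW (source set `A`, `|A| ∈ {0,2}`)
dressed by a gas of self- and mutually-avoiding simple LOOPS of fugacity `n` and DIMERS (doubled
edges) of fugacity `t`, edge fugacity `x`, everything pairwise vertex-disjoint:
`Σ_M (t x²)^{|M|} · Z^{tree}_{⟨n, 0, x⟩}(G, Λ ∖ V(M); A)`, the inner factor being the tree's dilute
non-crossing loop model at collision weight `w = 0` (strictly dilute) on the vertices not covered by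
dimers. At `(n, t) = (-2, -1)`: `det(1 - xA)` / `adj(1 - xA)_{ab}` (`Determinantal`); at `t = 0`:
the tree's `⟨n, 0, x⟩.partitionFunction`; at `(0, 0)`: the SAW generating function. -/
def dimerPF (n t x : K) (G : SimpleGraph (Site 2)) [G.LocallyFinite] (Λ A : Finset (Site 2)) : K :=
  ∑ M ∈ dimerConfigs G Λ A,
    (t * x ^ 2) ^ #M * (⟨n, 0, x⟩ : DiluteLoopModel K).partitionFunction G (Λ \ covered Λ M) A

/-- The normalised two-leg function `Z(G, Λ; {a} ∆ {b}) / Z(G, Λ; ∅)` of the dressed SAW. -/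
def twoLegDim (n t x : K) (G : SimpleGraph (Site 2)) [G.LocallyFinite] (Λ : Finset (Site 2))
    (a b : Site 2) : K :=
  dimerPF n t x G Λ ({a} ∆ {b}) / dimerPF n t x G Λ ∅

/-- The doubly normalised two-leg RATIO `twoLeg(G', Λ') / twoLeg(G, Λ)` (the route's `R`). -/
def ratioDim (n t x : K) (G' : SimpleGraph (Site 2)) [G'.LocallyFinite] (Λ' : Finset (Site 2))
    (G : SimpleGraph (Site 2)) [G.LocallyFinite] (Λ : Finset (Site 2)) (a b : Site 2) : K :=
  twoLegDim n t x G' Λ' a b / twoLegDim n t x G Λ a b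

/-- `Z` is a polynomial expression in `(n, t, x)`: it commutes with field homomorphisms. -/
theorem map_dimerPF {K' : Type*} [Field K'] (f : K →+* K') (n t x : K) (G : SimpleGraph (Site 2))
    [G.LocallyFinite] (Λ A : Finset (Site 2)) :
    f (dimerPF n t x G Λ A) = dimerPF (f n) (f t) (f x) G Λ A := by
  simp only [dimerPF, map_sum, map_mul, map_pow, DiluteLoopModel.map_partitionFunction,
    DiluteLoopModel.map, map_zero]

theorem map_twoLegDim {K' : Type*} [Field K'] (f : K →+* K') (n t x : K) (G : SimpleGraph (Site 2))
    [G.LocallyFinite] (Λ : Finset (Site 2)) (a b : Site 2) :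
    f (twoLegDim n t x G Λ a b) = twoLegDim (f n) (f t) (f x) G Λ a b := by
  rw [twoLegDim, twoLegDim, map_div₀, map_dimerPF, map_dimerPF]

theorem map_ratioDim {K' : Type*} [Field K'] (f : K →+* K') (n t x : K) (G' : SimpleGraph (Site 2))
    [G'.LocallyFinite] (Λ' : Finset (Site 2)) (G : SimpleGraph (Site 2)) [G.LocallyFinite]
    (Λ : Finset (Site 2)) (a b : Site 2) :
    f (ratioDim n t x G' Λ' G Λ a b) = ratioDim (f n) (f t) (f x) G' Λ' G Λ a b := by
  rw [ratioDim, ratioDim, map_div₀, map_twoLegDim, map_twoLegDim]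

end Model

/-! ## 2. The confined graph, the route's ratio `R_δ`, the intrinsic critical curve, the exponent -/

/-- **The CONFINED graph**: the edges of `Ω_δ = discreteDomainGraph Ω δ` whose closed segment lies in
`closure S` (same vertex set). A self-avoiding path of `Ω_δ` is a path of `confinedGraph Ω S δ` iff
its polyline lies in `closure S` — exactly the crux's event `rangeSubset (closure D')`. -/
def confinedGraph (Ω S : Set ℂ) (δ : ℝ) : SimpleGraph (Site 2) :=
  SimpleGraph.fromRel fun x y =>
    (discreteDomainGraph Ω δ).Adj x y ∧ segment ℝ (meshPoint δ x) (meshPoint δ y) ⊆ closure S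

theorem confinedGraph_le (Ω S : Set ℂ) (δ : ℝ) : confinedGraph Ω S δ ≤ discreteDomainGraph Ω δ := by
  intro x y h
  rw [confinedGraph, SimpleGraph.fromRel_adj] at h
  rcases h.2 with h' | h'
  · exact h'.1
  · exact h'.1.symm

theorem domainGraph_le_zdGraph (Ω : Set ℂ) (δ : ℝ) : discreteDomainGraph Ω δ ≤ zdGraph 2 :=
  (discreteDomainGraph_le_meshGraph Ω δ).trans (meshGraph_le_zdGraph Ω δ)

theorem confinedGraph_le_zdGraph (Ω S : Set ℂ) (δ : ℝ) : confinedGraph Ω S δ ≤ zdGraph 2 :=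
  (confinedGraph_le Ω S δ).trans (domainGraph_le_zdGraph Ω δ)

/-- The confined graph is locally finite (a subgraph of `ℤ²`). -/
instance instLocallyFiniteConfinedGraph (Ω S : Set ℂ) (δ : ℝ) : (confinedGraph Ω S δ).LocallyFinite :=
  fun x => (((zdGraph 2).neighborSet x).toFinite.subset
    (SimpleGraph.neighborSet_mono (confinedGraph_le_zdGraph Ω S δ) x)).fintype

/-- **`R_δ(n, t, x; Ω, S)`** — the doubly normalised two-leg boundary ratio of the dressed SAW between
the lattice points `a, b`: numerator on the confined graph (configurations inside `closure S`),
denominator on `Ω_δ`, common volume `meshDomainFinset Ω δ`. Over `K = ℝ` (real fugacities) or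
`K = ℂ` (complex loop fugacity, for analyticity). -/
def Rδ {K : Type*} [Field K] (n t x : K) (Ω S : Set ℂ) (δ : ℝ) (a b : Site 2) : K :=
  ratioDim n t x (confinedGraph Ω S δ) (meshDomainFinset Ω δ) (discreteDomainGraph Ω δ)
    (meshDomainFinset Ω δ) a b

theorem map_Rδ {K K' : Type*} [Field K] [Field K'] (f : K →+* K') (n t x : K) (Ω S : Set ℂ) (δ : ℝ)
    (a b : Site 2) : f (Rδ n t x Ω S δ a b) = Rδ (f n) (f t) (f x) Ω S δ a b := by
  rw [Rδ, Rδ, map_ratioDim]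

/-- Real parameters: the complex ratio is the real ratio. -/
theorem Rδ_ofReal (n t x : ℝ) (Ω S : Set ℂ) (δ : ℝ) (a b : Site 2) :
    Rδ (n : ℂ) (t : ℂ) (x : ℂ) Ω S δ a b = ((Rδ n t x Ω S δ a b : ℝ) : ℂ) := by
  have h := map_Rδ Complex.ofRealHom n t x Ω S δ a b
  simpa using h.symm

/-- The half-plane two-leg susceptibility `χ_N(n, t, x) = Σ_{b ∈ Λ_N} twoLeg(ℤ², Λ_N; 0, b)` of the
dressed SAW, `Λ_N = [-N, N] × [0, N]` (tree: `DiluteLoopModel.halfPlaneBox`). -/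
def halfPlaneSusceptibilityDim (n t x : ℝ) (N : ℕ) : ℝ :=
  ∑ b ∈ DiluteLoopModel.halfPlaneBox N, twoLegDim n t x (zdGraph 2) (DiluteLoopModel.halfPlaneBox N) 0 b

/-- **The intrinsic critical curve `x_c(n, t)`** of the dressed SAW (real parameters): the supremum of
the edge fugacities `x ∈ [0, 1]` at which the half-plane two-leg susceptibilities stay BOUNDED (in
absolute value — the weights are signed for `n < 0`) in `N`; the tree's
`DiluteLoopModel.criticalFugacity` convention made real-valued and two-sided (the cap `x ≤ 1` only
keeps the `sSup` of a bounded set honest: every critical value of the family lies in `[1/4, 1/μ]`).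
Expected: `x_c(-2, -1) = 1/4` (walks: `Σ_b G^{Λ_N}_x(0, b)` is bounded iff `x < 1/4`),
`x_c(0, 0) = 1/μ(ℤ²)` (`SAWCriticalPoint`). Accidental zeros of a finite-volume `Z(Λ_N; ∅)` are
harmless here (junk division gives `0`, not `∞`). -/
def xcDim (n t : ℝ) : ℝ :=
  sSup {x : ℝ | 0 ≤ x ∧ x ≤ 1 ∧
    Bornology.IsBounded (Set.range fun N : ℕ => halfPlaneSusceptibilityDim n t x N)}

/-- **The Coulomb-gas boundary one-leg exponent along the dilute branch**, as a function of the loop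
fugacity: `b = (6 - κ)/(2κ)`, `n = -2cos(4π/κ)` with `4π/κ = 2π - arccos(-n/2) ∈ [π, 2π]`, i.e.
`b(n) = 1 - (3/4π)·arccos(-n/2) = 1 - (3/2π)·arctan √((2+n)/(2-n))` (half-angle form, chosen so
that the complex continuation is Mathlib's `Complex.arctan ∘ cpow (1/2)`, holomorphic on the strip
`-2 < Re z < 2`, and so that the square-root onset at the anchor is manifest):
`b(-2) = 1` (excursion / LERW, `κ = 2`), `b(0) = 5/8` (SAW, `κ = 8/3`), `b(1) = 1/2` (Ising,
`κ = 3`); near the anchor `b(n) - 1 = -(3/2π)·√(n+2)/2 + O((n+2)^{3/2}) = -(3/4π)√(n+2) + …`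
(the anchor is a branch point, triage r1-3). Junk (`= 1`) for `n < -2`. -/
def bExp (n : ℝ) : ℝ := 1 - 3 * Real.arctan (Real.sqrt ((2 + n) / (2 - n))) / (2 * Real.pi)

theorem bExp_neg_two : bExp (-2) = 1 := by
  norm_num [bExp, Real.arctan_zero]

/-- `b(0) = 5/8`: the value that `AvoidanceLimit` asserts (cf. `avoidanceLimit_not_exp`: no other
exponent is compatible with the crux). -/
theorem bExp_zero : bExp 0 = 5 / 8 := by
  have hπ : Real.pi ≠ 0 := Real.pi_ne_zero
  have h : Real.sqrt ((2 + 0) / (2 - 0) : ℝ) = 1 := by norm_num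
  rw [bExp, h, Real.arctan_one]
  field_simp
  ring

/-- `b(1) = 1/2`: the route's Ising anchor value (`IsingBoundaryRatio`) sits on the same curve. -/
theorem bExp_one : bExp 1 = 1 / 2 := by
  have hπ : Real.pi ≠ 0 := Real.pi_ne_zero
  have h : Real.sqrt ((2 + 1) / (2 - 1) : ℝ) = Real.sqrt 3 := by norm_num
  rw [bExp, h, Real.arctan_sqrt_three]
  field_simp
  ring

/-! ## 3. Green's-function language for the anchor -/

/-- The adjacency matrix of `H` restricted to the volume `Λ`. -/
def adjMat (H : SimpleGraph (Site 2)) (Λ : Finset (Site 2)) : Matrix Λ Λ ℝ :=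
  open scoped Classical in fun u v => if H.Adj u.1 v.1 then 1 else 0

/-- The simple-random-walk Green's function of `H|_Λ` between `a` and `b`: the entry
`((1 - A/4)⁻¹)_{ab} = Σ_{walks a → b of H|_Λ} 4^{-|w|}` (walk on `ℤ²` killed when it attempts a step
that is not an edge of `H|_Λ`; Neumann series, spectral radius `< 4` on finite pieces of `ℤ²`);
junk `0` if `a ∉ Λ` or `b ∉ Λ`. -/
def greenEntry (H : SimpleGraph (Site 2)) (Λ : Finset (Site 2)) (a b : Site 2) : ℝ :=
  if h : a ∈ Λ ∧ b ∈ Λ then ((1 : Matrix Λ Λ ℝ) - (4 : ℝ)⁻¹ • adjMat H Λ)⁻¹ ⟨a, h.1⟩ ⟨b, h.2⟩ else 0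

/-- The ratio of Green's functions "walk confined to `closure S`" / "walk in `Ω_δ`" between `a, b`. -/
def greenRatio (Ω S : Set ℂ) (δ : ℝ) (a b : Site 2) : ℝ :=
  greenEntry (confinedGraph Ω S δ) (meshDomainFinset Ω δ) a b /
    greenEntry (discreteDomainGraph Ω δ) (meshDomainFinset Ω δ) a b

/-! ## 4. The statements of the line -/

/-- **S1 · SAWEndpointIdentity** (lattice identity at the SAW end, provable now, M). For bounded `Ω`,
`δ > 0` and `a ≠ b`, the critical-SAW probability that the polyline stays in `closure S` EQUALS the
doubly normalised ratio `R_δ(0, 0, x_c; Ω, S)`: at `(n, t) = (0, 0)` only `M = ∅` and the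
collision-free, loop-free configurations survive (`partitionFunction_zero_zero`), i.e. the
self-avoiding PATHS `a → b` (of the confined graph in the numerator: polyline `⊆ closure S` iff every
closed edge segment is), with `Z(·; ∅) = 1` (`partitionFunction_zero_zero_empty`), matching
`SAW.law = weight/weight(univ)`, `weight(γ) = x_c^{|γ|}` term by term. Junk cases agree
(no SAW: both sides `0`). -/
def SAWEndpointIdentity : Prop :=
  ∀ (Ω S : Set ℂ) (δ : ℝ) (a b : Site 2), Bornology.IsBounded Ω → 0 < δ → a ≠ b →
    ((SAW.law Ω δ a b).map (fun γ => γ.curve)) (CurveClass.rangeSubset (closure S)) =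
      ENNReal.ofReal (Rδ (0 : ℝ) 0 SAW.criticalFugacity Ω S δ a b)

/-- **S2 · Determinantal** (the dictionary at the anchor — adjugate path expansion; provable now, M).
On every finite piece `(H, Λ)` of `ℤ²`, at loop fugacity `-2` and dimer fugacity `-1` the dressed SAW
is a DETERMINANT: `Z(H,Λ;{a,b}) = adj(1 - xA)_{ab}` and `Z(H,Λ;∅) = det(1 - xA)` (`A` = adjacency
matrix of `H|_Λ`). Permutation expansion: a `k`-cycle along edges contributes `-x^k` in each of its
two orientations (`n = -2`), a transposition along an edge `-x²` (`t = -1`); the two-leg version is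
Cramer/chronological loop-erasure, `adj(1-xA)_{ab} = Σ_{paths p : a → b} x^{|p|} det((1-xA)|_{Λ∖p})`.
Verified in exact arithmetic on the `3×3`, `3×2`, `4×3`, `3×4` grids by the ideator and two triagers. -/
def Determinantal : Prop :=
  ∀ (H : SimpleGraph (Site 2)) [H.LocallyFinite], H ≤ zdGraph 2 →
    ∀ (Λ : Finset (Site 2)) (x : ℝ) (a b : Site 2) (ha : a ∈ Λ) (hb : b ∈ Λ), a ≠ b →
      dimerPF (-2 : ℝ) (-1) x H Λ ({a} ∆ {b}) =
          ((1 : Matrix Λ Λ ℝ) - x • adjMat H Λ).adjugate ⟨a, ha⟩ ⟨b, hb⟩ ∧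
        dimerPF (-2 : ℝ) (-1) x H Λ ∅ = ((1 : Matrix Λ Λ ℝ) - x • adjMat H Λ).det

/-- **S3 · ExcursionRatio** (the anchor in potential-theory language; provable now, M–L). For hull
data as in the crux, the ratio of SRW Green's functions between `a_δ` and `b_δ` — walk on `Ω_δ`
killed when it uses an edge whose segment leaves `closure D'`, over walk on `Ω_δ` — tends to
`d = Φ'_A(0)`: the Brownian EXCURSION from `a` to `b` in `D` stays in `closure D'` with probability
`H_{D'}(a,b)/H_D(a,b) = Φ'_A(0)^1` (restriction exponent `1`; chordal normalisation of `φ` and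
`Φ(z)/z → 1` at `∞` make the boundary Poisson-kernel factors at `a` and `b` cancel). Lattice proof:
strong Markov at the first exit of `B(a, ε/2)` and last entrance of `B(b, ε/2)`, inside which the two
graphs COINCIDE (ball agreement), then ratio limits of discrete harmonic functions (Kozdron–Lawler). -/
def ExcursionRatio : Prop :=
  ∀ (D D' : DobrushinDomain) (a b : ℝ → Site 2), SAW.IsEndpointApprox D a b →
    D'.carrier ⊆ D.carrier → D'.pt 0 = D.pt 0 → D'.pt 1 = D.pt 1 →
    (∃ ε : ℝ, 0 < ε ∧ D'.carrier ∩ Metric.ball (D.pt 0) ε = D.carrier ∩ Metric.ball (D.pt 0) ε ∧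
      D'.carrier ∩ Metric.ball (D.pt 1) ε = D.carrier ∩ Metric.ball (D.pt 1) ε) →
    ∀ (φ : ConformalEquiv UpperHalfPlane.upperHalfPlaneSet D.carrier), D.IsChordalUniformizing φ →
    ∀ (A : Set ℂ), A = closure (UpperHalfPlane.upperHalfPlaneSet \
      {z | z ∈ UpperHalfPlane.upperHalfPlaneSet ∧ φ z ∈ D'.carrier}) →
    ∀ (Φ : ConformalEquiv (UpperHalfPlane.upperHalfPlaneSet \ A) UpperHalfPlane.upperHalfPlaneSet)
      (d : ℝ), IsRestrictionMap A Φ → HasRestrictionDeriv A Φ d →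
    Tendsto (fun δ => greenRatio D.carrier D'.carrier δ (a δ) (b δ)) (𝓝[>] 0) (𝓝 d)

/-- **SymplecticAnchor** — the `n = -2` end of the flow in loop-model language (PROVED below from
`Determinantal` + `ExcursionRatio`, `symplecticAnchor_of`): along every hull datum the route's ratio
at `(n, t, x) = (-2, -1, 1/4)` tends to `d = d^{b(-2)}`. It is the hypothesis of the window stub. -/
def SymplecticAnchor : Prop :=
  ∀ (D D' : DobrushinDomain) (a b : ℝ → Site 2), SAW.IsEndpointApprox D a b →
    D'.carrier ⊆ D.carrier → D'.pt 0 = D.pt 0 → D'.pt 1 = D.pt 1 →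
    (∃ ε : ℝ, 0 < ε ∧ D'.carrier ∩ Metric.ball (D.pt 0) ε = D.carrier ∩ Metric.ball (D.pt 0) ε ∧
      D'.carrier ∩ Metric.ball (D.pt 1) ε = D.carrier ∩ Metric.ball (D.pt 1) ε) →
    ∀ (φ : ConformalEquiv UpperHalfPlane.upperHalfPlaneSet D.carrier), D.IsChordalUniformizing φ →
    ∀ (A : Set ℂ), A = closure (UpperHalfPlane.upperHalfPlaneSet \
      {z | z ∈ UpperHalfPlane.upperHalfPlaneSet ∧ φ z ∈ D'.carrier}) →
    ∀ (Φ : ConformalEquiv (UpperHalfPlane.upperHalfPlaneSet \ A) UpperHalfPlane.upperHalfPlaneSet)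
      (d : ℝ), IsRestrictionMap A Φ → HasRestrictionDeriv A Φ d →
    Tendsto (fun δ => Rδ (-2 : ℝ) (-1) 4⁻¹ D.carrier D'.carrier δ (a δ) (b δ)) (𝓝[>] 0) (𝓝 d)

/-- **S4 · SymplecticWindow** (conclusion; the stub is `SymplecticAnchor → SymplecticWindow`, XL, the
HARDEST: marginal constructive fermionic RG at the free symplectic fermion). There is `ε₀ ∈ (0, 1]`
such that for every `n ∈ (-2, -2+ε₀]`, along the path `(n, n/2, x_c(n, n/2))` and for every hull
datum, `lim_δ R_δ(n) = d^{b(n)}` with the Coulomb-gas exponent `bExp`. In Grassmann form the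
family is ONE Gaussian `(ψ̄, (1 - xA)ψ)` perturbed by
`(n+2)·[Σ_P x^{|P|} τ^P + (x²/2) Σ_E τ_u τ_v]`, `τ_v = ψ̄_v ψ_v` (coupling `n + 2 → 0`); the
fixed point reached by tuning `x` sits at distance `≍ √(n+2)` (saddle-node in `g = 4/κ`: `n(g)` is
even about `g = 2`), so the expansion parameter is `s = √(n+2)`, not `n + 2`. -/
def SymplecticWindow : Prop :=
  ∃ ε₀ : ℝ, 0 < ε₀ ∧ ε₀ ≤ 1 ∧ ∀ s ∈ Set.Ioc (-2 : ℝ) (-2 + ε₀),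
    ∀ (D D' : DobrushinDomain) (a b : ℝ → Site 2), SAW.IsEndpointApprox D a b →
    D'.carrier ⊆ D.carrier → D'.pt 0 = D.pt 0 → D'.pt 1 = D.pt 1 →
    (∃ ε : ℝ, 0 < ε ∧ D'.carrier ∩ Metric.ball (D.pt 0) ε = D.carrier ∩ Metric.ball (D.pt 0) ε ∧
      D'.carrier ∩ Metric.ball (D.pt 1) ε = D.carrier ∩ Metric.ball (D.pt 1) ε) →
    ∀ (φ : ConformalEquiv UpperHalfPlane.upperHalfPlaneSet D.carrier), D.IsChordalUniformizing φ →
    ∀ (A : Set ℂ), A = closure (UpperHalfPlane.upperHalfPlaneSet \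
      {z | z ∈ UpperHalfPlane.upperHalfPlaneSet ∧ φ z ∈ D'.carrier}) →
    ∀ (Φ : ConformalEquiv (UpperHalfPlane.upperHalfPlaneSet \ A) UpperHalfPlane.upperHalfPlaneSet)
      (d : ℝ), IsRestrictionMap A Φ → HasRestrictionDeriv A Φ d →
    Tendsto (fun δ => Rδ s (s / 2) (xcDim s (s / 2)) D.carrier D'.carrier δ (a δ) (b δ))
      (𝓝[>] 0) (𝓝 (d ^ bExp s))

/-- **S5 · FugacityContinuation** (`δ`-uniform analyticity in the loop fugacity AWAY from the anchor;
L–XL, Lee–Yang type). For every `η ∈ (0, 2)`: the intrinsic critical curve continues analytically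
(`Xc`) to a connected complex neighbourhood `U` of `[-2+η, 0]` inside the strip `-2 < Re z < 2`,
agreeing with `x_c(s, s/2)` at the real points `s ≤ 0` of `U`, and along it the complex ratio
`z ↦ R_δ(z, z/2, Xc z)` is, for every hull geometry, analytic on `U` and bounded there UNIFORMLY in
`δ ∈ (0, δ₀)` (zero-freeness of `Z(Ω_δ; ∅)`, `Z(Ω_δ; a, b)`, `Z^{conf}(∅)` on `U` — including the
real segment, where the weights are signed (triage r1-2) — plus local bounds). NOT claimed on any
neighbourhood of `-2` (√ branch point: `R_δ` is even in `√(n+2)`, triage r1-1/r1-3). -/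
def FugacityContinuation : Prop :=
  ∀ η : ℝ, 0 < η → η < 2 → ∃ (U : Set ℂ) (Xc : ℂ → ℂ),
    IsOpen U ∧ IsPreconnected U ∧ U ⊆ {z : ℂ | -2 < z.re ∧ z.re < 2} ∧
    (∀ s : ℝ, s ∈ Set.Icc (-2 + η) 0 → (s : ℂ) ∈ U) ∧ DifferentiableOn ℂ Xc U ∧
    (∀ s : ℝ, (s : ℂ) ∈ U → s ≤ 0 → Xc s = (xcDim s (s / 2) : ℂ)) ∧
    ∀ (D D' : DobrushinDomain) (a b : ℝ → Site 2), SAW.IsEndpointApprox D a b →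
      D'.carrier ⊆ D.carrier → D'.pt 0 = D.pt 0 → D'.pt 1 = D.pt 1 →
      (∃ ε : ℝ, 0 < ε ∧ D'.carrier ∩ Metric.ball (D.pt 0) ε = D.carrier ∩ Metric.ball (D.pt 0) ε ∧
        D'.carrier ∩ Metric.ball (D.pt 1) ε = D.carrier ∩ Metric.ball (D.pt 1) ε) →
      ∃ δ₀ : ℝ, 0 < δ₀ ∧ ∃ M : ℝ, ∀ δ ∈ Set.Ioo (0 : ℝ) δ₀,
        DifferentiableOn ℂ (fun z : ℂ => Rδ z (z / 2) (Xc z) D.carrier D'.carrier δ (a δ) (b δ)) U ∧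
        ∀ z ∈ U, ‖Rδ z (z / 2) (Xc z) D.carrier D'.carrier δ (a δ) (b δ)‖ ≤ M

/-- **S6 · VitaliTransport** (pure complex analysis, provable now, M). A family `f_δ` of holomorphic
functions on a connected open `U ⊆ {-2 < Re z < 2}` containing `[-2+η, 0]`, bounded by `M` uniformly
in `δ ∈ (0, δ₀)`, converging pointwise on a real sub-interval `(s₁, s₂) ⊆ [-2+η, 0]` to `d^{bExp s}`
(`d > 0`), converges at `0` to `d^{5/8}`: Vitali–Porter (Montel + identity theorem for subsequential
limits along any `δ_k → 0+`), the explicit continuation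
`h(z) = exp(log d · (1 - (3/2π)·Complex.arctan(((2+z)/(2-z))^{1/2})))`, holomorphic on the strip
(`(2+z)/(2-z) ∉ (-∞, 0]` there, its principal square root has positive real part, and
`Complex.arctan w = -(I/2) log((1+wI)/(1-wI))` is holomorphic off `±i[1, ∞)`; `Complex.ofReal_arctan`),
equal to `d^{bExp s}` at real `s ∈ (-2, 2)`, and `bExp 0 = 5/8`. -/
def VitaliTransport : Prop :=
  ∀ η : ℝ, 0 < η → η < 2 → ∀ (U : Set ℂ), IsOpen U → IsPreconnected U →
    U ⊆ {z : ℂ | -2 < z.re ∧ z.re < 2} → (∀ s : ℝ, s ∈ Set.Icc (-2 + η) 0 → (s : ℂ) ∈ U) →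
    ∀ (f : ℝ → ℂ → ℂ) (M δ₀ : ℝ), 0 < δ₀ →
    (∀ δ ∈ Set.Ioo (0 : ℝ) δ₀, DifferentiableOn ℂ (f δ) U ∧ ∀ z ∈ U, ‖f δ z‖ ≤ M) →
    ∀ d : ℝ, 0 < d → ∀ s₁ s₂ : ℝ, -2 + η ≤ s₁ → s₁ < s₂ → s₂ ≤ 0 →
    (∀ s ∈ Set.Ioo s₁ s₂, Tendsto (fun δ => f δ s) (𝓝[>] 0) (𝓝 ((d ^ bExp s : ℝ) : ℂ))) →
    Tendsto (fun δ => f δ 0) (𝓝[>] 0) (𝓝 ((d ^ ((5 : ℝ) / 8) : ℝ) : ℂ))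

/-- **S7 · SAWCriticalPoint** (known, provable now from the tree's Hammersley–Welsh bounds, M): the
intrinsic critical curve passes through the SAW point, `x_c(0, 0) = 1/μ(ℤ²)`. At `(0, 0, x)` the
half-plane two-leg susceptibility is `Σ x^{|γ|}` over self-avoiding walks from `0` inside
`[-N, N] × [0, N]` (incl. the trivial walk): bounded in `N` for `x < 1/μ` (`c_n ≤ μⁿ e^{κ√n}`,
`BDGS2012_HammersleyWelsh_holds`), unbounded for `x > 1/μ` (vertical bridges are such walks,
`e^{-c√n} μⁿ ≤ b_n`, `exp_mul_pow_le_bridgeCount` / `DKY2014_eq21_holds`); so the `sSup` over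
`[0, 1]` is `1/μ = SAW.criticalFugacity ∈ (1/3, 1/2]` whatever happens AT `1/μ`. -/
def SAWCriticalPoint : Prop :=
  xcDim 0 0 = SAW.criticalFugacity

/-! ## 5. Registered stubs -/

/-! The `stub_*` theorems are the registered obligations (sorried); `Registered.stub_*` are the
name-keyed `abbrev` aliases of their statements taken as the hypotheses of `AvoidanceLimit_of` (the
skeleton audit admits a hypothesis whose head's last name component is a declared stub — device of
`Summits/FinalStateConjecture/…/Cruxes/TameCensorship/Lines/necks-are-one-way-valves.lean`). -/
namespace Registered

abbrev stub_sawEndpoint : Prop := SAWEndpointIdentity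
abbrev stub_determinantal : Prop := Determinantal
abbrev stub_excursionRatio : Prop := ExcursionRatio
abbrev stub_symplecticWindow : Prop := SymplecticAnchor → SymplecticWindow
abbrev stub_fugacityContinuation : Prop := FugacityContinuation
abbrev stub_vitaliTransport : Prop := VitaliTransport
abbrev stub_sawCriticalPoint : Prop := SAWCriticalPoint

end Registered

/-- STUB S1 (M, provable now): the `n = 0` end of the ratio IS the crux's avoidance probability. -/
theorem stub_sawEndpoint : SAWEndpointIdentity := by
  sorry

/-- STUB S2 (M, provable now): adjugate path expansion / `det = loops(-2) + dimers(-1)`. -/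
theorem stub_determinantal : Determinantal := by
  sorry

/-- STUB S3 (M–L, provable now): excursion restriction exponent `1` for the killed SRW Green's function. -/
theorem stub_excursionRatio : ExcursionRatio := by
  sorry

/-- STUB S4 (XL, HARDEST — the bet of the line): the window out of the symplectic fermion. -/
theorem stub_symplecticWindow : SymplecticAnchor → SymplecticWindow := by
  sorry

/-- STUB S5 (L–XL): `δ`-uniform analytic continuation in the loop fugacity on `[-2+η, 0]`, every `η > 0`. -/
theorem stub_fugacityContinuation : FugacityContinuation := by
  sorry

/-- STUB S6 (M, provable now): Vitali–Porter transport of the Coulomb-gas exponent to `n = 0`. -/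
theorem stub_vitaliTransport : VitaliTransport := by
  sorry

/-- STUB S7 (M, provable now): `x_c(0,0) = 1/μ` (Hammersley–Welsh). -/
theorem stub_sawCriticalPoint : SAWCriticalPoint := by
  sorry

/-! ## 6. Glue (sorry-free) -/

/-- Along an endpoint approximation, eventually `δ > 0`, `a_δ ≠ b_δ` and both legs lie in the volume
`meshDomainFinset D δ` (uses `IsEndpointApprox.reachable` — Disproof: reachability is load-bearing). -/
theorem eventually_good {D : DobrushinDomain} {a b : ℝ → Site 2} (hab : SAW.IsEndpointApprox D a b) :
    ∀ᶠ δ in 𝓝[>] (0 : ℝ), 0 < δ ∧ a δ ≠ b δ ∧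
      a δ ∈ meshDomainFinset D.carrier δ ∧ b δ ∈ meshDomainFinset D.carrier δ := by
  have h0 : ∀ᶠ δ in 𝓝[>] (0 : ℝ), 0 < δ := eventually_mem_nhdsWithin
  have hpq : D.pt 0 ≠ D.pt 1 := fun h => absurd (D.pt_injective h) (by decide)
  have hr : 0 < dist (D.pt 0) (D.pt 1) / 2 := by
    have := dist_pos.2 hpq
    positivity
  have ha := (Metric.tendsto_nhds.1 hab.tendsto_fst) _ hr
  have hb := (Metric.tendsto_nhds.1 hab.tendsto_snd) _ hr
  have hne : ∀ᶠ δ in 𝓝[>] (0 : ℝ), a δ ≠ b δ := by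
    filter_upwards [ha, hb] with δ hδa hδb heq
    rw [heq] at hδa
    have h3 := dist_triangle (D.pt 0) (meshPoint δ (b δ)) (D.pt 1)
    rw [dist_comm] at hδa
    linarith
  filter_upwards [h0, hne, hab.reachable] with δ hδ hne hreach
  obtain ⟨p⟩ := hreach
  obtain ⟨w, hadj, -, -⟩ := p.exists_eq_cons_of_ne hne
  obtain ⟨w', hadj', -, -⟩ := p.reverse.exists_eq_cons_of_ne hne.symm
  have hD : Bornology.IsBounded D.carrier := D.isBounded
  have hmem : ∀ v, v ∈ meshDomain D.carrier δ → v ∈ meshDomainFinset D.carrier δ := fun v hv => by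
    rw [← Finset.mem_coe, coe_meshDomainFinset hD hδ]
    exact hv
  exact ⟨hδ, hne, hmem _ (discreteDomainGraph_adj_iff.1 hadj).2.1,
    hmem _ (discreteDomainGraph_adj_iff.1 hadj').2.1⟩

/-- At the anchor parameters the route's ratio IS the Green's-function ratio (by `Determinantal` and
`(1 - xA)⁻¹ = det⁻¹ · adj`). -/
theorem Rδ_anchor_eq_greenRatio (h2 : Determinantal) {Ω S : Set ℂ} {δ : ℝ} {a b : Site 2}
    (ha : a ∈ meshDomainFinset Ω δ) (hb : b ∈ meshDomainFinset Ω δ) (hne : a ≠ b) :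
    Rδ (-2 : ℝ) (-1) 4⁻¹ Ω S δ a b = greenRatio Ω S δ a b := by
  obtain ⟨e1, e1'⟩ := h2 (confinedGraph Ω S δ) (confinedGraph_le_zdGraph Ω S δ)
    (meshDomainFinset Ω δ) 4⁻¹ a b ha hb hne
  obtain ⟨e2, e2'⟩ := h2 (discreteDomainGraph Ω δ) (domainGraph_le_zdGraph Ω δ)
    (meshDomainFinset Ω δ) 4⁻¹ a b ha hb hne
  simp only [Rδ, ratioDim, twoLegDim, greenRatio, greenEntry, dif_pos (And.intro ha hb)]
  rw [e1, e1', e2, e2', Matrix.inv_def, Matrix.inv_def, Matrix.smul_apply, Matrix.smul_apply,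
    smul_eq_mul, smul_eq_mul, Ring.inverse_eq_inv, Ring.inverse_eq_inv]
  ring

/-- **The anchor is a theorem of the two provable-now stubs**: `Determinantal ∧ ExcursionRatio ⇒
SymplecticAnchor`. -/
theorem symplecticAnchor_of (h2 : Determinantal) (h3 : ExcursionRatio) : SymplecticAnchor := by
  intro D D' a b hab hsub h0 h1 hball φ hφ A hA Φ d hΦ hd
  refine (h3 D D' a b hab hsub h0 h1 hball φ hφ A hA Φ d hΦ hd).congr' ?_
  filter_upwards [eventually_good hab] with δ hδ
  exact (Rδ_anchor_eq_greenRatio h2 hδ.2.2.1 hδ.2.2.2 hδ.2.1).symm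

/-- The inline hull hypotheses of the crux give the tree's `IsHullSubdomain` (ball agreement ⇒ the
marked points are off `closure (D ∖ D')`). -/
theorem isHullSubdomain_of_ball {D D' : DobrushinDomain} (hsub : D'.carrier ⊆ D.carrier)
    (h0 : D'.pt 0 = D.pt 0) (h1 : D'.pt 1 = D.pt 1)
    (hball : ∃ ε : ℝ, 0 < ε ∧ D'.carrier ∩ Metric.ball (D.pt 0) ε = D.carrier ∩ Metric.ball (D.pt 0) ε ∧
      D'.carrier ∩ Metric.ball (D.pt 1) ε = D.carrier ∩ Metric.ball (D.pt 1) ε) :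
    D.IsHullSubdomain D' := by
  obtain ⟨ε, hε, hb0, hb1⟩ := hball
  have key : ∀ p : ℂ, D'.carrier ∩ Metric.ball p ε = D.carrier ∩ Metric.ball p ε →
      p ∉ closure (D.carrier \ D'.carrier) := by
    intro p hp hmem
    rw [mem_closure_iff_nhds] at hmem
    obtain ⟨z, hzb, hzD, hzD'⟩ := hmem (Metric.ball p ε) (Metric.ball_mem_nhds p hε)
    have hz : z ∈ D'.carrier ∩ Metric.ball p ε := by rw [hp]; exact ⟨hzD, hzb⟩
    exact hzD' hz.1
  exact ⟨hsub, h0, h1, key _ hb0, key _ hb1⟩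

/-- **The composition (kernel-checked, no `sorry` here): the seven registered stubs imply the crux
`AvoidanceLimit` BY NAME.** Anchor (`S2 + S3`) ⇒ window (`S4`) on `(-2, -2+ε₀]` along `xcDim`;
continuation (`S5`) at `η = ε₀/2`; Vitali transport (`S6`) of `d^{bExp}` from the overlap
`(-2+ε₀/2, -2+ε₀)` to `0` (with `0 < d` from the chordal pull-back being a `*`-hull); the curve hits
the SAW point (`S7`); the ratio at `(0,0,x_c)` is the avoidance probability (`S1`). -/
theorem AvoidanceLimit_of :
    Registered.stub_sawEndpoint → Registered.stub_determinantal → Registered.stub_excursionRatio →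
      Registered.stub_symplecticWindow → Registered.stub_fugacityContinuation →
      Registered.stub_vitaliTransport → Registered.stub_sawCriticalPoint → AvoidanceLimit := by
  intro h1 h2 h3 h4 h5 h6 h7 D D' a b hab hsub hp0 hp1 hball φ hφ A hA Φ d hΦ hd
  -- (0) `0 < d`: the pulled-back hull of a hull subdomain under a CHORDAL uniformizer is a `*`-hull.
  have hHull : D.IsHullSubdomain D' := isHullSubdomain_of_ball hsub hp0 hp1 hball
  have hstar : IsStarHull A := by
    rw [hA]
    exact IsStarHull.pullbackHull JordanDomain.isSimplyConnected_holds hφ hHull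
  obtain ⟨d', hd'0, -, hd'⟩ := IsStarHull.exists_hasRestrictionDeriv_holds hstar hΦ
  have hdpos : 0 < d := by rwa [hd.unique hstar hd']
  -- (1) the anchor, (2) the window
  have hAnchor : SymplecticAnchor := symplecticAnchor_of h2 h3
  obtain ⟨ε₀, hε₀, hε₁, hW⟩ := h4 hAnchor
  -- (3) continuation at `η = ε₀ / 2`
  obtain ⟨U, Xc, hUo, hUc, hUstrip, hUseg, -, hXreal, hB⟩ :=
    h5 (ε₀ / 2) (by positivity) (by linarith)
  obtain ⟨δ₀, hδ₀, M, hFM⟩ := hB D D' a b hab hsub hp0 hp1 hball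
  -- the family to transport
  set f : ℝ → ℂ → ℂ := fun δ z => Rδ z (z / 2) (Xc z) D.carrier D'.carrier δ (a δ) (b δ) with hf
  have hreal : ∀ s : ℝ, (s : ℂ) ∈ U → s ≤ 0 → ∀ δ,
      f δ s = ((Rδ s (s / 2) (xcDim s (s / 2)) D.carrier D'.carrier δ (a δ) (b δ) : ℝ) : ℂ) := by
    intro s hsU hs0 δ
    simp only [hf]
    rw [hXreal s hsU hs0, show (s : ℂ) / 2 = ((s / 2 : ℝ) : ℂ) by push_cast; ring, Rδ_ofReal]
  -- (4) pointwise limits on the overlap `(-2 + ε₀/2, -2 + ε₀)` from the window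
  have hlim : ∀ s ∈ Set.Ioo (-2 + ε₀ / 2) (-2 + ε₀),
      Tendsto (fun δ => f δ s) (𝓝[>] 0) (𝓝 ((d ^ bExp s : ℝ) : ℂ)) := by
    intro s hs
    have hsU : (s : ℂ) ∈ U := hUseg s ⟨hs.1.le, by linarith [hs.2]⟩
    have hs0 : s ≤ 0 := by linarith [hs.2]
    have hw := hW s ⟨by linarith [hs.1], hs.2.le⟩ D D' a b hab hsub hp0 hp1 hball φ hφ A hA Φ d hΦ hd
    have hfun : (fun δ => f δ s) =
        fun δ => ((Rδ s (s / 2) (xcDim s (s / 2)) D.carrier D'.carrier δ (a δ) (b δ) : ℝ) : ℂ) :=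
      funext (hreal s hsU hs0)
    rw [hfun]
    exact (Complex.continuous_ofReal.tendsto _).comp hw
  -- (5) Vitali transport to `0`
  have key := h6 (ε₀ / 2) (by positivity) (by linarith) U hUo hUc hUstrip hUseg f M δ₀ hδ₀ hFM d hdpos
    (-2 + ε₀ / 2) (-2 + ε₀) le_rfl (by linarith) (by linarith) hlim
  -- (6) at `0` the curve is the SAW point
  have h0U : ((0 : ℝ) : ℂ) ∈ U := hUseg 0 ⟨by linarith, le_rfl⟩
  have hf0 : ∀ δ, f δ 0 =
      ((Rδ (0 : ℝ) 0 SAW.criticalFugacity D.carrier D'.carrier δ (a δ) (b δ) : ℝ) : ℂ) := by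
    intro δ
    have h7' : xcDim 0 0 = SAW.criticalFugacity := h7
    have h := hreal 0 h0U le_rfl δ
    rw [zero_div, h7'] at h
    simpa using h
  have hC : Tendsto (fun δ => ((Rδ (0 : ℝ) 0 SAW.criticalFugacity D.carrier D'.carrier δ (a δ) (b δ) : ℝ) : ℂ))
      (𝓝[>] 0) (𝓝 ((d ^ ((5 : ℝ) / 8) : ℝ) : ℂ)) := by
    have hfun : (fun δ => f δ 0) =
        fun δ => ((Rδ (0 : ℝ) 0 SAW.criticalFugacity D.carrier D'.carrier δ (a δ) (b δ) : ℝ) : ℂ) :=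
      funext hf0
    rw [← hfun]
    exact key
  have hR : Tendsto (fun δ => Rδ (0 : ℝ) 0 SAW.criticalFugacity D.carrier D'.carrier δ (a δ) (b δ))
      (𝓝[>] 0) (𝓝 (d ^ ((5 : ℝ) / 8))) := by
    have h := (Complex.continuous_re.tendsto _).comp hC
    rw [Complex.ofReal_re] at h
    exact h.congr' (Eventually.of_forall fun δ => Complex.ofReal_re _)
  -- (7) the ratio at `(0, 0, x_c)` is the avoidance probability, eventually in `δ`
  refine (ENNReal.tendsto_ofReal hR).congr' ?_
  filter_upwards [eventually_good hab] with δ hδ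
  exact (h1 D.carrier D'.carrier δ (a δ) (b δ) D.isBounded hδ.1 hδ.2.1).symm

/-- Hypothesis-free form of the skeleton: the crux modulo the seven sorried stubs. -/
example : AvoidanceLimit :=
  AvoidanceLimit_of stub_sawEndpoint stub_determinantal stub_excursionRatio stub_symplecticWindow
    stub_fugacityContinuation stub_vitaliTransport stub_sawCriticalPoint

/-! ## 7. Checks against the landed `Negative/` lemmas (imported) -/

/-- The value the line produces is THE exponent of the crux family (`avoidanceLimitExp_iff`), and the
crux excludes every other exponent (`avoidanceLimit_not_exp`): the line's `5/8` is `bExp 0`, not an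
exponent-blind covariance statement. -/
example : bExp 0 = 5 / 8 ∧
    (AvoidanceLimit → ¬ Theorems.AvoidanceLimit.Negative.AvoidanceLimitExp 1) :=
  ⟨bExp_zero, fun h => Theorems.AvoidanceLimit.Negative.avoidanceLimit_not_exp_one h⟩

/-! ## R. Refuter probes (drefute seat): the `D' = D` shadows of S3 / S4 / S5

Instantiating the hull data at the trivial hull subdomain `D' = D` (pulled-back hull `A = ∅`,
`Φ_∅ = id`, `d = 1`, any chordal uniformizer from `MarkedDomain.exists_isChordalUniformizing_holds`)
collapses the doubly normalised ratio to `T/T ∈ {0, 1}`, `T` = the two-leg function of `Ω_δ`.  What the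
analytic stubs then assert is a statement about ZEROS of signed / complex finite-volume partition
functions, for EVERY Jordan domain and endpoint approximation. -/

section Drefute

/-- At `S = Ω` the confined graph is `Ω_δ` itself (`meshGraph` already asks the closed edge to lie in
`closure Ω`). -/
theorem confinedGraph_self (Ω : Set ℂ) (δ : ℝ) : confinedGraph Ω Ω δ = discreteDomainGraph Ω δ := by
  ext x y
  rw [confinedGraph, SimpleGraph.fromRel_adj]
  constructor
  · rintro ⟨-, h | h⟩
    · exact h.1
    · exact h.1.symm
  · intro h
    exact ⟨h.ne, Or.inl ⟨h, (meshGraph_adj_iff.1 (discreteDomainGraph_adj_iff.1 h).1).2⟩⟩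

section KField

variable {K : Type*} [Field K]

/-- `dimerPF` does not depend on the `LocallyFinite` structure: it transports along graph equality. -/
theorem dimerPF_congr {G G' : SimpleGraph (Site 2)} [iG : G.LocallyFinite] [iG' : G'.LocallyFinite]
    (h : G = G') (n t x : K) (Λ A : Finset (Site 2)) :
    @dimerPF K _ n t x G iG Λ A = @dimerPF K _ n t x G' iG' Λ A := by
  subst h
  have : iG = iG' := Subsingleton.elim _ _
  subst this
  rfl

theorem twoLegDim_congr {G G' : SimpleGraph (Site 2)} [iG : G.LocallyFinite] [iG' : G'.LocallyFinite]
    (h : G = G') (n t x : K) (Λ : Finset (Site 2)) (a b : Site 2) :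
    @twoLegDim K _ n t x G iG Λ a b = @twoLegDim K _ n t x G' iG' Λ a b := by
  rw [twoLegDim, twoLegDim, dimerPF_congr h, dimerPF_congr h (A := ∅)]

/-- **The `D' = D` ratio is `T / T`**, `T` the two-leg function of `Ω_δ` between `a` and `b`. -/
theorem Rδ_self (n t x : K) (Ω : Set ℂ) (δ : ℝ) (a b : Site 2) :
    Rδ n t x Ω Ω δ a b =
      twoLegDim n t x (discreteDomainGraph Ω δ) (meshDomainFinset Ω δ) a b /
        twoLegDim n t x (discreteDomainGraph Ω δ) (meshDomainFinset Ω δ) a b := by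
  rw [Rδ, ratioDim, twoLegDim_congr (confinedGraph_self Ω δ)]

end KField

/-- `T/T → 1` along a filter iff `T ≠ 0` eventually (real-valued). -/
theorem tendsto_div_self_iff {ι : Type*} {l : Filter ι} (T : ι → ℝ) :
    Tendsto (fun i => T i / T i) l (𝓝 1) ↔ ∀ᶠ i in l, T i ≠ 0 := by
  constructor
  · intro h
    have h' : ∀ᶠ i in l, T i / T i ∈ Set.Ioi (1 / 2 : ℝ) := h (Ioi_mem_nhds (by norm_num))
    filter_upwards [h'] with i hi h0
    rw [Set.mem_Ioi, h0, div_zero] at hi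
    norm_num at hi
  · intro h
    refine (tendsto_const_nhds (x := (1 : ℝ))).congr' ?_
    filter_upwards [h] with i hi
    rw [div_self hi]

/-- The greens-function ratio at `D' = D` is `g/g`. -/
theorem greenRatio_self (Ω : Set ℂ) (δ : ℝ) (a b : Site 2) :
    greenRatio Ω Ω δ a b =
      greenEntry (discreteDomainGraph Ω δ) (meshDomainFinset Ω δ) a b /
        greenEntry (discreteDomainGraph Ω δ) (meshDomainFinset Ω δ) a b := by
  rw [greenRatio, confinedGraph_self]

/-- **Shadow of S3 at `D' = D`**: `ExcursionRatio` asserts in particular that the killed-SRW Green's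
function `G_{Ω_δ}(a_δ, b_δ)` is eventually non-zero (true and harmless: it is positive as soon as
`a_δ, b_δ` are joined in `Ω_δ`). Recorded to show the instantiation pattern type-checks. -/
theorem excursionRatio_self (h3 : ExcursionRatio) (D : DobrushinDomain) (a b : ℝ → Site 2)
    (hab : SAW.IsEndpointApprox D a b) :
    ∀ᶠ δ in 𝓝[>] (0 : ℝ),
      greenEntry (discreteDomainGraph D.carrier δ) (meshDomainFinset D.carrier δ) (a δ) (b δ) ≠ 0 := by
  obtain ⟨φ, hφ⟩ := MarkedDomain.exists_isChordalUniformizing_holds D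
  have h := h3 D D a b hab subset_rfl rfl rfl ⟨1, one_pos, rfl, rfl⟩ φ hφ ∅
    (Theorems.AvoidanceLimit.Negative.empty_eq_pullback_self φ) restrictionMapEmpty 1
    isRestrictionMap_empty hasRestrictionDeriv_empty
  simp_rw [greenRatio_self] at h
  exact (tendsto_div_self_iff _).1 h

/-- **Shadow of S4 at `D' = D` (what `SymplecticWindow` secretly asserts about zeros).** For every `s`
in the window, every Dobrushin domain `D` and endpoint approximation: EVENTUALLY IN `δ` the SIGNED
finite-volume two-leg function `T = Z_{s,s/2,x_c(s)}(Ω_δ; a_δ, b_δ) / Z_{s,s/2,x_c(s)}(Ω_δ; ∅)` is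
non-zero, i.e. BOTH signed partition functions are non-zero (`twoLegDim_ne_zero_iff`). A persistent
zero of `Z_{s,s/2,x_c(s,s/2)}(Ω_{δ_k}; ∅)` along `δ_k → 0` for ONE Jordan domain and ONE `s` in every
`(-2, -2+ε₀]` would falsify S4's conclusion. -/
theorem symplecticWindow_self (hW : SymplecticWindow) :
    ∃ ε₀ : ℝ, 0 < ε₀ ∧ ∀ s ∈ Set.Ioc (-2 : ℝ) (-2 + ε₀),
      ∀ (D : DobrushinDomain) (a b : ℝ → Site 2), SAW.IsEndpointApprox D a b →
        ∀ᶠ δ in 𝓝[>] (0 : ℝ),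
          twoLegDim s (s / 2) (xcDim s (s / 2)) (discreteDomainGraph D.carrier δ)
            (meshDomainFinset D.carrier δ) (a δ) (b δ) ≠ 0 := by
  obtain ⟨ε₀, hε₀, -, hW⟩ := hW
  refine ⟨ε₀, hε₀, fun s hs D a b hab => ?_⟩
  obtain ⟨φ, hφ⟩ := MarkedDomain.exists_isChordalUniformizing_holds D
  have h := hW s hs D D a b hab subset_rfl rfl rfl ⟨1, one_pos, rfl, rfl⟩ φ hφ ∅
    (Theorems.AvoidanceLimit.Negative.empty_eq_pullback_self φ) restrictionMapEmpty 1
    isRestrictionMap_empty hasRestrictionDeriv_empty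
  rw [Real.one_rpow] at h
  simp_rw [Rδ_self] at h
  exact (tendsto_div_self_iff _).1 h

/-- The two-leg function vanishes iff one of the two partition functions does. -/
theorem twoLegDim_ne_zero_iff {K : Type*} [Field K] (n t x : K) (G : SimpleGraph (Site 2))
    [G.LocallyFinite] (Λ : Finset (Site 2)) (a b : Site 2) :
    twoLegDim n t x G Λ a b ≠ 0 ↔ dimerPF n t x G Λ ({a} ∆ {b}) ≠ 0 ∧ dimerPF n t x G Λ ∅ ≠ 0 := by
  rw [twoLegDim, div_ne_zero_iff]

/-- **Shadow of S5 at `D' = D` (δ-uniform zero-freeness in the COMPLEX loop fugacity).** On the fixed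
complex neighbourhood `U ⊇ [-2+η, 0]`, for every Dobrushin domain and endpoint approximation there is
`δ₀ > 0` such that for EVERY `δ ∈ (0, δ₀)` the complex two-leg function
`T_δ(z) = Z_{z,z/2,Xc z}(Ω_δ; a_δ,b_δ)/Z_{z,z/2,Xc z}(Ω_δ; ∅)` is either ZERO-FREE ON ALL OF `U` or
identically `0` on `U`; since `T_δ(0) = Z_{SAW}(a_δ, b_δ; x_c) > 0` for small `δ` (reachability,
`Xc 0 = xcDim 0 0 > 0`), this is δ-uniform absence of Lee–Yang zeros in `n` of BOTH partition functions
on `U` along the complexified critical curve, for every Jordan domain — the falsifiable core of S5. -/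
theorem fugacityContinuation_self (h5 : FugacityContinuation) {η : ℝ} (hη : 0 < η) (hη2 : η < 2) :
    ∃ (U : Set ℂ) (Xc : ℂ → ℂ), IsOpen U ∧ IsPreconnected U ∧
      (∀ s : ℝ, s ∈ Set.Icc (-2 + η) 0 → (s : ℂ) ∈ U) ∧
      (∀ s : ℝ, (s : ℂ) ∈ U → s ≤ 0 → Xc s = (xcDim s (s / 2) : ℂ)) ∧
      ∀ (D : DobrushinDomain) (a b : ℝ → Site 2), SAW.IsEndpointApprox D a b →
        ∃ δ₀ : ℝ, 0 < δ₀ ∧ ∀ δ ∈ Set.Ioo (0 : ℝ) δ₀,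
          (∀ z ∈ U, twoLegDim z (z / 2) (Xc z) (discreteDomainGraph D.carrier δ)
              (meshDomainFinset D.carrier δ) (a δ) (b δ) ≠ 0) ∨
          (∀ z ∈ U, twoLegDim z (z / 2) (Xc z) (discreteDomainGraph D.carrier δ)
              (meshDomainFinset D.carrier δ) (a δ) (b δ) = 0) := by
  obtain ⟨U, Xc, hUo, hUc, -, hUseg, -, hXreal, hB⟩ := h5 η hη hη2
  refine ⟨U, Xc, hUo, hUc, hUseg, hXreal, fun D a b hab => ?_⟩
  obtain ⟨δ₀, hδ₀, M, hFM⟩ := hB D D a b hab subset_rfl rfl rfl ⟨1, one_pos, rfl, rfl⟩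
  refine ⟨δ₀, hδ₀, fun δ hδ => ?_⟩
  obtain ⟨hdiff, -⟩ := hFM δ hδ
  simp_rw [Rδ_self] at hdiff
  set T : ℂ → ℂ := fun z => twoLegDim z (z / 2) (Xc z) (discreteDomainGraph D.carrier δ)
    (meshDomainFinset D.carrier δ) (a δ) (b δ) with hT
  change DifferentiableOn ℂ (fun z => T z / T z) U at hdiff
  by_contra hcon
  push Not at hcon
  obtain ⟨⟨z₁, hz₁, hT₁⟩, ⟨z₀, hz₀, hT₀⟩⟩ := hcon
  have hT₁' : T z₁ = 0 := hT₁
  have hT₀' : T z₀ ≠ 0 := hT₀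
  have hcont : ContinuousOn (fun z => (T z / T z).re) U :=
    Complex.continuous_re.comp_continuousOn hdiff.continuousOn
  have hIVT := hUc.intermediate_value hz₁ hz₀ hcont
  have hmem : (1 / 2 : ℝ) ∈ Set.Icc ((T z₁ / T z₁).re) ((T z₀ / T z₀).re) := by
    rw [hT₁', div_zero, Complex.zero_re, div_self hT₀', Complex.one_re]
    norm_num
  obtain ⟨w, -, hw'⟩ := hIVT hmem
  change (T w / T w).re = 1 / 2 at hw'
  by_cases hTw : T w = 0
  · rw [hTw, div_zero, Complex.zero_re] at hw'
    norm_num at hw'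
  · rw [div_self hTw, Complex.one_re] at hw'
    norm_num at hw'

end Drefute

end Summit.CriticalPhenomena.SAWScalingLimit.Cruxes.AvoidanceLimit.SymplecticFermionAnchor

end
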